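import Literature.InformationTheory.QuantumCodes.KnillLaflammeTheorem
import HarnessLib

/-!
# The Knill–Laflamme conditions: codeword (subspace) form and orthonormal-basis form

Venture QEC (cell `qec`, PARTITION row 03; known mathematics, hence under `Literature/`).
`KnillLaflamme.lean` states the quantum error-correction conditions in Nielsen–Chuang's projector
form `P E_a† E_b P = α_ab P` (`KnillLaflammeCondition`). This file records the two other printed
shapes and proves them equivalent:

* `KnillLaflammeSubspaceCondition C E` — codeword form on a subspace `C`:
  `⟨ψ| E_a† E_b |φ⟩ = α_ab ⟨ψ|φ⟩` for all `ψ, φ ∈ C` (`α` Hermitian); equivalent to the projector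
  form for any orthogonal projector `P` with `C = {v | P v = v}`
  (`knillLaflammeCondition_iff_subspace`) — this is the form in which a stabilizer code's
  code space `C(S)` (a `Submodule`) meets the conditions;
* `KnillLaflammeBasisCondition v E` — Knill–Laflamme's Theorem 3.2 as printed, for an orthonormal
  basis `|i_L⟩ = v i` of the code: for `i ≠ j`,
  `⟨i_L|A_a†A_b|i_L⟩ = ⟨j_L|A_a†A_b|j_L⟩` and `⟨i_L|A_a†A_b|j_L⟩ = 0`;
  `knillLaflammeCondition_iff_basis` (equivalence with the projector form for
  `P = Σ_i |i_L⟩⟨i_L|`) and **`isCorrectable_iff_knillLaflammeBasisCondition`** — Theorem 3.2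
  verbatim: "the code `𝒞` can be extended to an `𝒜`-correcting code iff" the two displayed
  conditions hold — proved (via `isCorrectable_iff_knillLaflammeCondition`).

## References
* E. Knill, R. Laflamme, *Theory of quantum error-correcting codes*, Phys. Rev. A 55 (1997)
  900–911, arXiv:quant-ph/9604034, §3.2 Theorem 3.2 (chunk p0008 of `lit read`).
* M. A. Nielsen, I. L. Chuang, *Quantum Computation and Quantum Information*, CUP 2010, §10.3
  Theorem 10.1 eq. (10.16), p. 436.
-/

noncomputable section

namespace Literature.InformationTheory.QuantumCodes

open Matrix Literature.Computability.QuantumComplexity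
open scoped ComplexOrder

variable {n : Type*} [Fintype n] [DecidableEq n]
variable {ι : Type*} [Fintype ι]

/-! ### Matrix elements against a projector -/

omit [DecidableEq n] in
/-- Two matrices with the same matrix elements `⟨x|A|y⟩` are equal. [folklore] -/
private theorem ext_of_star_dotProduct_mulVec [DecidableEq n] {A B : Matrix n n ℂ}
    (h : ∀ x y : n → ℂ, star x ⬝ᵥ (A *ᵥ y) = star x ⬝ᵥ (B *ᵥ y)) : A = B := by
  ext i j
  have := h (Pi.single i 1) (Pi.single j 1)
  rwa [← Pi.single_star, star_one, single_dotProduct, single_dotProduct, one_mul, one_mul,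
    mulVec_single_one, mulVec_single_one] at this

omit [DecidableEq n] in
/-- For Hermitian `P`: `⟨x| (P M P) |y⟩ = ⟨P x| M |P y⟩`. [folklore] -/
private theorem star_dotProduct_proj_mul_proj_mulVec {P : Matrix n n ℂ} (hP : P.IsHermitian)
    (M : Matrix n n ℂ) (x y : n → ℂ) :
    star x ⬝ᵥ ((P * M * P) *ᵥ y) = star (P *ᵥ x) ⬝ᵥ (M *ᵥ (P *ᵥ y)) := by
  rw [star_mulVec, hP.eq, ← mulVec_mulVec, ← mulVec_mulVec, dotProduct_mulVec]

omit [DecidableEq n] in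
/-- For Hermitian idempotent `P`: `⟨P x|P y⟩ = ⟨x|P y⟩`. [folklore] -/
private theorem star_proj_dotProduct_proj {P : Matrix n n ℂ} (hP : P.IsHermitian)
    (hPP : P * P = P) (x y : n → ℂ) : star (P *ᵥ x) ⬝ᵥ (P *ᵥ y) = star x ⬝ᵥ (P *ᵥ y) := by
  rw [star_mulVec, hP.eq, ← dotProduct_mulVec, mulVec_mulVec, hPP]

/-! ### Codeword (subspace) form -/

/-- The quantum error-correction conditions in **codeword form** on a subspace `C`: there is a
Hermitian matrix `α` with `⟨ψ| E_a† E_b |φ⟩ = α_ab ⟨ψ|φ⟩` for all codewords `ψ, φ ∈ C` — the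
matrix elements of eq. (10.16) `P E_a† E_b P = α_ab P` between vectors of `C = range P`
(equivalence: `knillLaflammeCondition_iff_subspace`). (definition)
[cite: NielsenChuang2010, Thm 10.1 eq. (10.16), p. 436 (matrix elements on C)] -/
def KnillLaflammeSubspaceCondition (C : Submodule ℂ (n → ℂ)) (E : ι → Matrix n n ℂ) : Prop :=
  ∃ α : Matrix ι ι ℂ, α.IsHermitian ∧
    ∀ a b, ∀ ψ ∈ C, ∀ φ ∈ C, star ψ ⬝ᵥ (((E a)ᴴ * E b) *ᵥ φ) = α a b * (star ψ ⬝ᵥ φ)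

omit [DecidableEq n] [Fintype ι] in
/-- **Projector form ⇔ codeword form.** For an orthogonal projector `P` (`P† = P = P²`) and the
subspace `C = {v | P v = v}` it projects onto, `P E_a† E_b P = α_ab P` for all `a, b` iff
`⟨ψ|E_a†E_b|φ⟩ = α_ab ⟨ψ|φ⟩` for all `ψ, φ ∈ C` (same Hermitian `α`).
[cite: NielsenChuang2010, Thm 10.1 eq. (10.16), p. 436] -/
theorem knillLaflammeCondition_iff_subspace {P : Matrix n n ℂ} (hP : P.IsHermitian)
    (hPP : P * P = P) (C : Submodule ℂ (n → ℂ)) (hC : ∀ v, v ∈ C ↔ P *ᵥ v = v)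
    (E : ι → Matrix n n ℂ) : KnillLaflammeCondition P E ↔ KnillLaflammeSubspaceCondition C E := by
  classical
  constructor
  · rintro ⟨α, hα, h⟩
    refine ⟨α, hα, fun a b ψ hψ φ hφ => ?_⟩
    rw [hC] at hψ hφ
    have hab := h a b
    rw [Matrix.mul_assoc P] at hab
    have := congr_arg (fun A : Matrix n n ℂ => star ψ ⬝ᵥ (A *ᵥ φ)) hab
    rwa [star_dotProduct_proj_mul_proj_mulVec hP, hψ, hφ, smul_mulVec, dotProduct_smul, hφ,
      smul_eq_mul] at this
  · rintro ⟨α, hα, h⟩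
    refine ⟨α, hα, fun a b => ext_of_star_dotProduct_mulVec fun x y => ?_⟩
    have hx : P *ᵥ (P *ᵥ x) = P *ᵥ x := by rw [mulVec_mulVec, hPP]
    have hy : P *ᵥ (P *ᵥ y) = P *ᵥ y := by rw [mulVec_mulVec, hPP]
    rw [Matrix.mul_assoc P, star_dotProduct_proj_mul_proj_mulVec hP,
      h a b _ ((hC _).mpr hx) _ ((hC _).mpr hy), star_proj_dotProduct_proj hP hPP, smul_mulVec,
      dotProduct_smul, smul_eq_mul]

/-! ### Orthonormal-basis form (Knill–Laflamme, Theorem 3.2) -/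

/-- Knill–Laflamme's conditions for an orthonormal basis `|i_L⟩ = v i` of the code and the error
family `A_a = E a`: "for all basis elements `|i_L⟩, |j_L⟩` (`i ≠ j`) and operators `A_a, A_b`
in `𝒜`: `⟨i_L|A_a†A_b|i_L⟩ = ⟨j_L|A_a†A_b|j_L⟩` and `⟨i_L|A_a†A_b|j_L⟩ = 0`." (definition;
the printed THEOREM is `isCorrectable_iff_knillLaflammeBasisCondition`)
[cite: KnillLaflamme1997, Thm 3.2 (the two displayed equations)] -/
def KnillLaflammeBasisCondition {m : Type*} (v : m → n → ℂ) (E : ι → Matrix n n ℂ) : Prop :=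
  (∀ a b i j, i ≠ j →
    star (v i) ⬝ᵥ (((E a)ᴴ * E b) *ᵥ v i) = star (v j) ⬝ᵥ (((E a)ᴴ * E b) *ᵥ v j)) ∧
  (∀ a b i j, i ≠ j → star (v i) ⬝ᵥ (((E a)ᴴ * E b) *ᵥ v j) = 0)

section Basis

variable {m : Type*} [Fintype m] [DecidableEq m] {v : m → n → ℂ}

/-- The projector `P = Σ_i |i_L⟩⟨i_L|` onto the span of an orthonormal family.
[cite: NielsenChuang2010, §10.3 ("P = |000⟩⟨000| + |111⟩⟨111|"), p. 435] -/
def basisProj (v : m → n → ℂ) : Matrix n n ℂ := ∑ i, vecMulVec (v i) (star (v i))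

omit [Fintype n] [DecidableEq n] [DecidableEq m] in
/-- `P = Σ_i |i_L⟩⟨i_L|` is Hermitian. [cite: NielsenChuang2010, §10.3, p. 435] -/
theorem isHermitian_basisProj (v : m → n → ℂ) : (basisProj v).IsHermitian := by
  rw [IsHermitian, basisProj, conjTranspose_sum]
  exact Finset.sum_congr rfl fun i _ => by rw [conjTranspose_vecMulVec, star_star]

omit [DecidableEq n] in
/-- `P |j_L⟩ = |j_L⟩` for an orthonormal family. [cite: NielsenChuang2010, §10.3, p. 435] -/
theorem basisProj_mulVec (hv : ∀ i j, star (v i) ⬝ᵥ v j = if i = j then 1 else 0) (j : m) :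
    basisProj v *ᵥ v j = v j := by
  rw [basisProj, sum_mulVec]
  simp_rw [vecMulVec_mulVec, op_smul_eq_smul, hv, ite_smul, one_smul, zero_smul]
  rw [Finset.sum_ite_eq' Finset.univ j, if_pos (Finset.mem_univ j)]

omit [DecidableEq n] in
/-- `⟨j_L| P = ⟨j_L|` for an orthonormal family. [cite: NielsenChuang2010, §10.3, p. 435] -/
theorem star_vecMul_basisProj (hv : ∀ i j, star (v i) ⬝ᵥ v j = if i = j then 1 else 0)
    (j : m) : star (v j) ᵥ* basisProj v = star (v j) := by
  rw [basisProj, vecMul_sum]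
  simp_rw [vecMul_vecMulVec, hv, @eq_comm _ j, ite_smul, one_smul, zero_smul]
  rw [Finset.sum_ite_eq' Finset.univ j, if_pos (Finset.mem_univ j)]

omit [DecidableEq n] in
/-- `P² = P` for an orthonormal family. [cite: NielsenChuang2010, §10.3, p. 435] -/
theorem basisProj_mul_self (hv : ∀ i j, star (v i) ⬝ᵥ v j = if i = j then 1 else 0) :
    basisProj v * basisProj v = basisProj v :=
  calc basisProj v * basisProj v = ∑ i, vecMulVec (v i) (star (v i)) * basisProj v :=
        Finset.sum_mul _ _ _
    _ = basisProj v :=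
        Finset.sum_congr rfl fun i _ => by rw [vecMulVec_mul, star_vecMul_basisProj hv]

omit [DecidableEq n] [DecidableEq m] in
/-- `P |x⟩ ∈ span`: `P x = x` iff `x = Σ_i ⟨i_L|x⟩ |i_L⟩`; in particular the fixed space of
`P` is the span of the family. Recorded as: `P x = Σ_i ⟨i_L|x⟩ • |i_L⟩`.
[cite: NielsenChuang2010, §10.3, p. 435] -/
theorem basisProj_mulVec_eq_sum (x : n → ℂ) :
    basisProj v *ᵥ x = ∑ i, (star (v i) ⬝ᵥ x) • v i := by
  rw [basisProj, sum_mulVec]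
  simp_rw [vecMulVec_mulVec, op_smul_eq_smul]

omit [DecidableEq n] [DecidableEq m] in
/-- Matrix elements of `P M P` in the basis: `P M P = Σ_{i,j} ⟨i_L|M|j_L⟩ |i_L⟩⟨j_L|`.
[cite: KnillLaflamme1997, proof of Thm 3.2] -/
theorem basisProj_mul_mul_basisProj (M : Matrix n n ℂ) :
    basisProj v * M * basisProj v =
      ∑ i, ∑ j, (star (v i) ⬝ᵥ (M *ᵥ v j)) • vecMulVec (v i) (star (v j)) := by
  rw [basisProj, Finset.sum_mul, Finset.sum_mul]
  refine Finset.sum_congr rfl fun i _ => ?_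
  rw [Finset.mul_sum]
  refine Finset.sum_congr rfl fun j _ => ?_
  rw [vecMulVec_mul, vecMulVec_mul_vecMulVec, ← dotProduct_mulVec, vecMulVec_smul]

omit [DecidableEq n] [Fintype ι] in
/-- **Projector form ⇔ basis form** (Knill–Laflamme Thm 3.2 vs Nielsen–Chuang (10.16)): for an
orthonormal basis `|i_L⟩` of the code and `P = Σ_i |i_L⟩⟨i_L|`, `P E_a†E_b P = α_ab P` (`α`
Hermitian) iff the two displayed conditions of Theorem 3.2 hold.
[cite: KnillLaflamme1997, Thm 3.2] -/
theorem knillLaflammeCondition_iff_basis (hv : ∀ i j, star (v i) ⬝ᵥ v j = if i = j then 1 else 0)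
    (E : ι → Matrix n n ℂ) : KnillLaflammeCondition (basisProj v) E ↔ KnillLaflammeBasisCondition v E := by
  classical
  -- matrix elements of the projector form between basis vectors
  have key : ∀ {α : Matrix ι ι ℂ} {a b : ι},
      basisProj v * (E a)ᴴ * E b * basisProj v = α a b • basisProj v →
      ∀ i j, star (v i) ⬝ᵥ (((E a)ᴴ * E b) *ᵥ v j) = if i = j then α a b else 0 := by
    intro α a b h i j
    rw [Matrix.mul_assoc (basisProj v)] at h
    have := congr_arg (fun A : Matrix n n ℂ => star (v i) ⬝ᵥ (A *ᵥ v j)) h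
    rwa [star_dotProduct_proj_mul_proj_mulVec (isHermitian_basisProj v),
      basisProj_mulVec hv, basisProj_mulVec hv, smul_mulVec, dotProduct_smul, basisProj_mulVec hv,
      hv, smul_eq_mul, mul_ite, mul_one, mul_zero] at this
  constructor
  · rintro ⟨α, -, h⟩
    refine ⟨fun a b i j hij => ?_, fun a b i j hij => ?_⟩
    · rw [key (h a b), key (h a b), if_pos rfl, if_pos rfl]
    · rw [key (h a b), if_neg hij]
  · rintro ⟨hdiag, hoff⟩
    by_cases hm : Nonempty m
    · obtain ⟨i₀⟩ := hm
      let α : Matrix ι ι ℂ := Matrix.of fun a b => star (v i₀) ⬝ᵥ (((E a)ᴴ * E b) *ᵥ v i₀)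
      have hα : ∀ a b, α a b = star (v i₀) ⬝ᵥ (((E a)ᴴ * E b) *ᵥ v i₀) := fun a b => rfl
      refine ⟨α, ?_, fun a b => ?_⟩
      · refine Matrix.IsHermitian.ext fun a b => ?_
        rw [hα, hα, ← star_dotProduct, star_mulVec, conjTranspose_mul, conjTranspose_conjTranspose,
          dotProduct_mulVec]
      · have hd : ∀ i, star (v i) ⬝ᵥ (((E a)ᴴ * E b) *ᵥ v i) = α a b := by
          intro i
          by_cases hi : i = i₀
          · rw [hi, hα]
          · rw [hα, hdiag a b i i₀ hi]
        rw [Matrix.mul_assoc (basisProj v), basisProj_mul_mul_basisProj, basisProj, Finset.smul_sum]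
        refine Finset.sum_congr rfl fun i _ => ?_
        rw [Finset.sum_eq_single i]
        · rw [hd]
        · intro j _ hji
          rw [hoff a b i j (Ne.symm hji), zero_smul]
        · exact fun h => absurd (Finset.mem_univ i) h
    · refine ⟨0, isHermitian_zero, fun a b => ?_⟩
      have he : (Finset.univ : Finset m) = ∅ :=
        Finset.univ_eq_empty_iff.mpr (not_nonempty_iff.mp hm)
      rw [basisProj, he, Finset.sum_empty, Matrix.mul_zero, smul_zero]

/-- **Knill–Laflamme, Theorem 3.2.** "The code `𝒞` can be extended to an `𝒜`-correcting code iff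
for all basis elements `|i_L⟩, |j_L⟩` (`i ≠ j`) and operators `A_a, A_b` in `𝒜`:
`⟨i_L|A_a†A_b|i_L⟩ = ⟨j_L|A_a†A_b|j_L⟩` and `⟨i_L|A_a†A_b|j_L⟩ = 0`." Here the code is the span
of the orthonormal family `v` (projector `basisProj v = Σ_i |i_L⟩⟨i_L|`), "extended to an
`𝒜`-correcting code" = `IsCorrectable` (some trace-preserving recovery `ℛ` with `(ℛ∘𝒜)(PρP) ∝ PρP`).
(proved) [cite: KnillLaflamme1997, Thm 3.2] -/
theorem isCorrectable_iff_knillLaflammeBasisCondition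
    (hv : ∀ i j, star (v i) ⬝ᵥ v j = if i = j then 1 else 0) (E : ι → Matrix n n ℂ) :
    IsCorrectable (basisProj v) E ↔ KnillLaflammeBasisCondition v E := by
  classical
  rw [isCorrectable_iff_knillLaflammeCondition (isHermitian_basisProj v) (basisProj_mul_self hv),
    knillLaflammeCondition_iff_basis hv]

end Basis

end Literature.InformationTheory.QuantumCodes
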